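import Summits.Ventures.CertifiedArithmetic.LowPrec.DoubleRoundingProduct

/-!
# Double rounding of products — the named cells (THEOREM D-dm, matrix level)

HONEST FRAMING: certified error envelopes and provably optimal rounding/accumulation schemes for
low-precision formats under stated cost models; every table by two implementations; no hardware
or vendor claims.

The cells of the `13 × 13` record matrix of `DOUBLE-ROUNDING-MUL.md` that are not literal
instances of the clauses (E) / (U) / (N) of `DoubleRoundingProduct.lean`, plus the headline FP8
instances of (E) / (U):

* all FP8 products through binary16 — e4m3, binary8p4, binary8p4f (= fnuz e4m3), binary8p5 by
  (E) (`448² > 65504` etc. saturate on both routes); e5m2, binary8p3, binary8p3f (= fnuz e5m2) by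
  (U) (binary16 cannot hold `2^-32`, yet the double rounding is innocuous) — and through
  bfloat16 / binary32 by (E); FP6 / FP4 and binary16 products through binary16 / binary32 by
  (E); bfloat16 products through binary32 by (U) (not always exact, always correctly rounded);
* binary8p3 / binary8p4 through their extended-range variants binary8p3f / binary8p4f: SAME
  GRID, LARGER TOP ⇒ `fl_φ ∘ fl_ψ = fl_φ` everywhere (`toRat_roundNE_roundNE_of_sameGrid`);
* e2m1 products through the precision-3 formats (`P_Y = 3 < 2 P_X`): innocuous, by kernel
  exhaustion of all `16²` operand pairs per cell (`drMul_of_all`);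
* the twelve failing embedded cells, one kernel-evaluated witness pair each: equal precision does
  NOT suffice for products (e3m2 → e5m2 / binary8p3 / binary8p3f, e5m2 → binary8p3f, e2m3 → e4m3 /
  binary8p4 / binary8p4f: `fl_ψ` acts where `ψ` is normal and `φ` subnormal), nor does
  `P_X < P_Y < 2 P_X` (e3m2 → the `P = 4` formats, again through the subnormal range of e3m2;
  e2m3 → binary8p5 and binary8p5 → bfloat16 in the normal range).

Implementation A: `code/enum/doublemul_decision.py` (brute force over every FP4/FP6 source cell,
pair scans over the 8-bit sources, the same witnesses through exact rational roundings).
PLACEMENT as in `DoubleRoundingProduct.lean`: the clause shape is KNOWN [Figueroa1995, §3;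
Roux2014, Table II]; the finite matrix over these records is this cell's table. No hardware or
vendor claims.
-/

namespace Summit.Ventures.CertifiedArithmetic

open Literature.ComputerArithmetic.FloatingPoint
open Literature.ComputerArithmetic.FloatingPoint.Format
open Literature.ComputerArithmetic.FloatingPoint.MiniFloat

/-! ## §0 Same grid, larger top: every double rounding is innocuous -/

/-- SAME GRID, LARGER TOP. If `ψ` has the same rounding grid as `φ` (same `manBits`,
`emaxCode` and `bias`, hence the same unclamped RNE multiple `rneMult` and quantum) and at least
the range of `φ` (`maxScaled`, i.e. `topMan`), then `fl_φ ∘ fl_ψ = fl_φ` at EVERY rational — so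
double rounding through `ψ` is innocuous for every operation (binary8p3 through binary8p3f,
binary8p4 through binary8p4f: the P3109 extended-range variants only add top codes).
[cite: IEEE7542019, §4.3.1] -/
theorem toRat_roundNE_roundNE_of_sameGrid {φ ψ : Format} (hm : ψ.manBits = φ.manBits)
    (he : ψ.emaxCode = φ.emaxCode) (hb : ψ.bias = φ.bias) (hM : φ.maxScaled ≤ ψ.maxScaled)
    (t : ℚ) : (roundNE φ (roundNE ψ t).toRat).toRat = (roundNE φ t).toRat := by
  have hg : ∀ r, ψ.rneMult r = φ.rneMult r := fun r => by
    unfold Format.rneMult Format.shift; rw [hm, he]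
  have hq : ψ.quantum = φ.quantum := by unfold Format.quantum Format.qexp; rw [hm, hb]
  have hqφ := φ.quantum_pos
  have hr : 0 ≤ |t| / φ.quantum := div_nonneg (abs_nonneg t) hqφ.le
  have hψ := toRat_roundNE (φ := ψ) t
  have hφ := toRat_roundNE (φ := φ) t
  rw [hq, Format.rneGrid_eq_min, hg] at hψ
  rw [Format.rneGrid_eq_min] at hφ
  set R := φ.rneMult (|t| / φ.quantum) with hR
  rcases le_or_gt R φ.maxScaled with hle | hlt
  · -- no clamping in `φ`, hence none in `ψ`: the intermediate value is a value of `φ`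
    rw [min_eq_left (hle.trans hM)] at hψ
    rw [min_eq_left hle] at hφ
    have hrep : φ.Representable R := by
      have := Format.rneGrid_representable (φ := φ) hr
      rwa [Format.rneGrid_eq_min, min_eq_left hle] at this
    have habs : |(roundNE ψ t).toRat| = (R : ℚ) * φ.quantum := by
      rw [hψ]; split <;> simp [abs_mul, abs_of_pos hqφ]
    rw [toRat_roundNE_of_exists (exists_toRat_eq_of_abs_eq_natMul hrep habs), hψ, hφ]
  · -- clamping in `φ`: the intermediate value is at or beyond `± maxRat φ`
    rw [min_eq_right hlt.le] at hφ
    have hge : (φ.maxScaled : ℚ) * φ.quantum ≤ (min R ψ.maxScaled : ℕ) * φ.quantum := by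
      apply mul_le_mul_of_nonneg_right _ hqφ.le
      exact_mod_cast le_min hlt.le hM
    by_cases ht : t < 0
    · rw [if_pos ht] at hψ hφ
      have hy : (roundNE ψ t).toRat ≤ -φ.maxRat := by
        rw [hψ]; unfold Format.maxRat; linarith
      have := toRat_roundNE_of_maxRat_le_pos (φ := φ) (x := -(roundNE ψ t).toRat) (by linarith)
      rw [toRat_roundNE_neg, neg_eq_iff_eq_neg] at this
      rw [this, hφ]; unfold Format.maxRat; ring
    · rw [if_neg ht] at hψ hφ
      have hy : φ.maxRat ≤ (roundNE ψ t).toRat := by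
        rw [hψ]; unfold Format.maxRat; exact hge
      rw [toRat_roundNE_of_maxRat_le_pos hy, hφ]; unfold Format.maxRat; rfl

/-- THE P3109 EXTENDED-RANGE VARIANTS: binary8p3 through binary8p3f and binary8p4 through
binary8p4f — every double rounding is innocuous (same grid, one more top code), in particular
that of products. -/
theorem P3109_mul_via_extended :
    (∀ a b : MiniFloat Binary8p3,
      (roundNE Binary8p3 (roundNE Binary8p3F (a.toRat * b.toRat)).toRat).toRat
        = (roundNE Binary8p3 (a.toRat * b.toRat)).toRat) ∧
    (∀ a b : MiniFloat Binary8p4,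
      (roundNE Binary8p4 (roundNE Binary8p4F (a.toRat * b.toRat)).toRat).toRat
        = (roundNE Binary8p4 (a.toRat * b.toRat)).toRat) :=
  ⟨fun _ _ => toRat_roundNE_roundNE_of_sameGrid (φ := Binary8p3) (ψ := Binary8p3F) rfl rfl rfl
      (by decide +kernel) _,
    fun _ _ => toRat_roundNE_roundNE_of_sameGrid (φ := Binary8p4) (ψ := Binary8p4F) rfl rfl rfl
      (by decide +kernel) _⟩

/-! ## §1 Exhaustion and the FP8 cells -/

/-- A product cell by exhaustion of all operand pairs (FP4 / FP6 sources only). -/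
theorem drMul_of_all {φ ψ : Format}
    (h : ((all φ).all fun a => (all φ).all fun b =>
      decide ((roundNE φ (roundNE ψ (a.toRat * b.toRat)).toRat).toRat
        = (roundNE φ (a.toRat * b.toRat)).toRat)) = true) :
    ∀ a b : MiniFloat φ, (roundNE φ (roundNE ψ (a.toRat * b.toRat)).toRat).toRat
      = (roundNE φ (a.toRat * b.toRat)).toRat :=
  fun a b => of_decide_eq_true (forall₂_of_all_all (P := fun a b : MiniFloat φ =>
    decide ((roundNE φ (roundNE ψ (a.toRat * b.toRat)).toRat).toRat
      = (roundNE φ (a.toRat * b.toRat)).toRat)) h a b)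

/-- FP8 PRODUCTS THROUGH binary16 — e4m3 by clause (E) (`-24 ≤ 2 · (-9)`; products up to
`448² > 65504` saturate on both routes), e5m2 by clause (U) (`-24 + 6 ≤ -16`: binary16 cannot hold
`2^-32`, yet double rounding is innocuous). -/
theorem OCP_mul_via_Binary16 :
    (∀ a b : MiniFloat E4M3, (roundNE E4M3 (roundNE Binary16 (a.toRat * b.toRat)).toRat).toRat
      = (roundNE E4M3 (a.toRat * b.toRat)).toRat) ∧
    (∀ a b : MiniFloat E5M2, (roundNE E5M2 (roundNE Binary16 (a.toRat * b.toRat)).toRat).toRat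
      = (roundNE E5M2 (a.toRat * b.toRat)).toRat) :=
  ⟨drMul_of_exact_of_embedsTest (by decide +kernel) (by decide) (by decide +kernel),
    drMul_of_underflow_of_embedsTest (by decide +kernel) (by decide) (by decide)
      (by decide +kernel)⟩

/-- P3109 PRODUCTS THROUGH binary16 — binary8p4, binary8p4f (= fnuz e4m3), binary8p5 by clause
(E); binary8p3, binary8p3f (= fnuz e5m2) by clause (U) (`-24 + 6 ≤ -17`). -/
theorem P3109_mul_via_Binary16 :
    (∀ a b : MiniFloat Binary8p3,
      (roundNE Binary8p3 (roundNE Binary16 (a.toRat * b.toRat)).toRat).toRat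
        = (roundNE Binary8p3 (a.toRat * b.toRat)).toRat) ∧
    (∀ a b : MiniFloat Binary8p3F,
      (roundNE Binary8p3F (roundNE Binary16 (a.toRat * b.toRat)).toRat).toRat
        = (roundNE Binary8p3F (a.toRat * b.toRat)).toRat) ∧
    (∀ a b : MiniFloat Binary8p4,
      (roundNE Binary8p4 (roundNE Binary16 (a.toRat * b.toRat)).toRat).toRat
        = (roundNE Binary8p4 (a.toRat * b.toRat)).toRat) ∧
    (∀ a b : MiniFloat Binary8p4F,
      (roundNE Binary8p4F (roundNE Binary16 (a.toRat * b.toRat)).toRat).toRat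
        = (roundNE Binary8p4F (a.toRat * b.toRat)).toRat) ∧
    (∀ a b : MiniFloat Binary8p5,
      (roundNE Binary8p5 (roundNE Binary16 (a.toRat * b.toRat)).toRat).toRat
        = (roundNE Binary8p5 (a.toRat * b.toRat)).toRat) :=
  ⟨drMul_of_underflow_of_embedsTest (by decide +kernel) (by decide) (by decide)
      (by decide +kernel),
    drMul_of_underflow_of_embedsTest (by decide +kernel) (by decide) (by decide)
      (by decide +kernel),
    drMul_of_exact_of_embedsTest (by decide +kernel) (by decide) (by decide +kernel),
    drMul_of_exact_of_embedsTest (by decide +kernel) (by decide) (by decide +kernel),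
    drMul_of_exact_of_embedsTest (by decide +kernel) (by decide) (by decide +kernel)⟩

/-- ALL FP8 PRODUCTS THROUGH bfloat16 AND binary32 are exact or saturated (clause (E)):
e4m3, e5m2 shown; `P_Y = 8 ≥ 2 · 4`, `qexp = -133 ≤ -18`. -/
theorem OCP_mul_via_BFloat16_Binary32 :
    (∀ a b : MiniFloat E4M3, (roundNE E4M3 (roundNE BFloat16 (a.toRat * b.toRat)).toRat).toRat
      = (roundNE E4M3 (a.toRat * b.toRat)).toRat) ∧
    (∀ a b : MiniFloat E5M2, (roundNE E5M2 (roundNE BFloat16 (a.toRat * b.toRat)).toRat).toRat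
      = (roundNE E5M2 (a.toRat * b.toRat)).toRat) ∧
    (∀ a b : MiniFloat E4M3, (roundNE E4M3 (roundNE Binary32 (a.toRat * b.toRat)).toRat).toRat
      = (roundNE E4M3 (a.toRat * b.toRat)).toRat) ∧
    (∀ a b : MiniFloat E5M2, (roundNE E5M2 (roundNE Binary32 (a.toRat * b.toRat)).toRat).toRat
      = (roundNE E5M2 (a.toRat * b.toRat)).toRat) :=
  ⟨drMul_of_exact_of_embedsTest (by decide +kernel) (by decide) (by decide +kernel),
    drMul_of_exact_of_embedsTest (by decide +kernel) (by decide) (by decide +kernel),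
    drMul_of_exact_of_embedsTest (by decide +kernel) (by decide) (by decide +kernel),
    drMul_of_exact_of_embedsTest (by decide +kernel) (by decide) (by decide +kernel)⟩

/-- 16-BIT PRODUCTS THROUGH binary32: binary16 by clause (E) (`-149 ≤ -48`), bfloat16 by clause
(U) (`-149 + 16 ≤ -133`): a bfloat16 product formed in binary32 is NOT always exact (two small
operands need bits below `2^-149`), yet rounding it to bfloat16 is always correct. -/
theorem Binary16_BFloat16_mul_via_Binary32 :
    (∀ a b : MiniFloat Binary16,
      (roundNE Binary16 (roundNE Binary32 (a.toRat * b.toRat)).toRat).toRat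
        = (roundNE Binary16 (a.toRat * b.toRat)).toRat) ∧
    (∀ a b : MiniFloat BFloat16,
      (roundNE BFloat16 (roundNE Binary32 (a.toRat * b.toRat)).toRat).toRat
        = (roundNE BFloat16 (a.toRat * b.toRat)).toRat) :=
  ⟨drMul_of_exact_of_embedsTest (by decide +kernel) (by decide) (by decide +kernel),
    drMul_of_underflow_of_embedsTest (by decide +kernel) (by decide) (by decide)
      (by decide +kernel)⟩

/-- FP6 / FP4 PRODUCTS THROUGH binary16 are exact (clause (E); `P_Y = 11 ≥ 8`). -/
theorem FP6_FP4_mul_via_Binary16 :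
    (∀ a b : MiniFloat E2M1, (roundNE E2M1 (roundNE Binary16 (a.toRat * b.toRat)).toRat).toRat
      = (roundNE E2M1 (a.toRat * b.toRat)).toRat) ∧
    (∀ a b : MiniFloat E3M2, (roundNE E3M2 (roundNE Binary16 (a.toRat * b.toRat)).toRat).toRat
      = (roundNE E3M2 (a.toRat * b.toRat)).toRat) ∧
    (∀ a b : MiniFloat E2M3, (roundNE E2M3 (roundNE Binary16 (a.toRat * b.toRat)).toRat).toRat
      = (roundNE E2M3 (a.toRat * b.toRat)).toRat) :=
  ⟨drMul_of_exact_of_embedsTest (by decide +kernel) (by decide) (by decide +kernel),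
    drMul_of_exact_of_embedsTest (by decide +kernel) (by decide) (by decide +kernel),
    drMul_of_exact_of_embedsTest (by decide +kernel) (by decide) (by decide +kernel)⟩

/-- e2m1 PRODUCTS THROUGH THE PRECISION-3 FORMATS (`P_Y = 3 < 2 P_X = 4`, outside both clauses)
are nevertheless innocuously double rounded: kernel exhaustion of all `16²` operand pairs each
(the only inexact products are `1.5 · 1.5 · 2^k = 1.001₂ · 2^(k+1)`, ties of `Y` that resolve
to the even neighbour, itself an e2m1 value or above its range). -/
theorem E2M1_mul_via_precision3 :
    (∀ a b : MiniFloat E2M1, (roundNE E2M1 (roundNE E3M2 (a.toRat * b.toRat)).toRat).toRat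
      = (roundNE E2M1 (a.toRat * b.toRat)).toRat) ∧
    (∀ a b : MiniFloat E2M1, (roundNE E2M1 (roundNE E5M2 (a.toRat * b.toRat)).toRat).toRat
      = (roundNE E2M1 (a.toRat * b.toRat)).toRat) ∧
    (∀ a b : MiniFloat E2M1, (roundNE E2M1 (roundNE Binary8p3 (a.toRat * b.toRat)).toRat).toRat
      = (roundNE E2M1 (a.toRat * b.toRat)).toRat) ∧
    (∀ a b : MiniFloat E2M1, (roundNE E2M1 (roundNE Binary8p3F (a.toRat * b.toRat)).toRat).toRat
      = (roundNE E2M1 (a.toRat * b.toRat)).toRat) :=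
  ⟨drMul_of_all (by decide +kernel), drMul_of_all (by decide +kernel),
    drMul_of_all (by decide +kernel), drMul_of_all (by decide +kernel)⟩

/-! ## §2 The failing embedded cells -/

/-- EQUAL PRECISION DOES NOT SUFFICE FOR PRODUCTS (clause (S) of D-dr is for sums): e3m2 → e5m2,
binary8p3, binary8p3f (`P = 3` each, `F_e3m2 ⊆ F_Y`): `a = b = 3/16`, `a · b = 9/256 ↦ 1/32` (a tie
of `Y`) `↦ 0` (a tie of e3m2, even side), while `fl_e3m2(9/256) = 1/16`; e5m2 → binary8p3f:
`2^-16 · 5/8 ↦ 2^-17 ↦ 0` against `2^-16` — the "double rounding on underflow" of a wider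
exponent range at equal precision (the x87 store-reload phenomenon), at FP6 / FP8 size. -/
theorem samePrecision_mul_fails :
    (¬ ∀ a b : MiniFloat E3M2, (roundNE E3M2 (roundNE E5M2 (a.toRat * b.toRat)).toRat).toRat
      = (roundNE E3M2 (a.toRat * b.toRat)).toRat) ∧
    (¬ ∀ a b : MiniFloat E3M2, (roundNE E3M2 (roundNE Binary8p3 (a.toRat * b.toRat)).toRat).toRat
      = (roundNE E3M2 (a.toRat * b.toRat)).toRat) ∧
    (¬ ∀ a b : MiniFloat E3M2,
      (roundNE E3M2 (roundNE Binary8p3F (a.toRat * b.toRat)).toRat).toRat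
        = (roundNE E3M2 (a.toRat * b.toRat)).toRat) ∧
    (¬ ∀ a b : MiniFloat E5M2,
      (roundNE E5M2 (roundNE Binary8p3F (a.toRat * b.toRat)).toRat).toRat
        = (roundNE E5M2 (a.toRat * b.toRat)).toRat) := by
  refine ⟨fun h => ?_, fun h => ?_, fun h => ?_, fun h => ?_⟩
  · have := h ⟨false, 0, 3, by decide, by decide, by decide⟩
      ⟨false, 0, 3, by decide, by decide, by decide⟩
    revert this; decide +kernel
  · have := h ⟨false, 0, 3, by decide, by decide, by decide⟩
      ⟨false, 0, 3, by decide, by decide, by decide⟩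
    revert this; decide +kernel
  · have := h ⟨false, 0, 3, by decide, by decide, by decide⟩
      ⟨false, 0, 3, by decide, by decide, by decide⟩
    revert this; decide +kernel
  · have := h ⟨false, 0, 1, by decide, by decide, by decide⟩
      ⟨false, 14, 1, by decide, by decide, by decide⟩
    revert this; decide +kernel

/-- THE `P = 4` FP8 FORMATS FAIL AS INTERMEDIATES FOR BOTH FP6 SOURCES: e3m2 → e4m3, binary8p4,
binary8p4f (`P_X = 3 < P_Y = 4`; `3/16 · 7/8 = 21/128 ↦ 5/32 ↦ 1/8`, direct `3/16`) and e2m3 →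
e4m3, binary8p4, binary8p4f (`P_X = P_Y = 4`, equal precision; `3/8 · 7/8 = 21/64 ↦ 5/16 ↦ 1/4`,
direct `3/8`); each time `fl_ψ` acts in the normal range of `ψ` where `φ` is subnormal. -/
theorem precisionDeficient_mul_fails_P4 :
    (¬ ∀ a b : MiniFloat E3M2, (roundNE E3M2 (roundNE E4M3 (a.toRat * b.toRat)).toRat).toRat
      = (roundNE E3M2 (a.toRat * b.toRat)).toRat) ∧
    (¬ ∀ a b : MiniFloat E3M2, (roundNE E3M2 (roundNE Binary8p4 (a.toRat * b.toRat)).toRat).toRat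
      = (roundNE E3M2 (a.toRat * b.toRat)).toRat) ∧
    (¬ ∀ a b : MiniFloat E3M2,
      (roundNE E3M2 (roundNE Binary8p4F (a.toRat * b.toRat)).toRat).toRat
        = (roundNE E3M2 (a.toRat * b.toRat)).toRat) ∧
    (¬ ∀ a b : MiniFloat E2M3, (roundNE E2M3 (roundNE E4M3 (a.toRat * b.toRat)).toRat).toRat
      = (roundNE E2M3 (a.toRat * b.toRat)).toRat) ∧
    (¬ ∀ a b : MiniFloat E2M3, (roundNE E2M3 (roundNE Binary8p4 (a.toRat * b.toRat)).toRat).toRat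
      = (roundNE E2M3 (a.toRat * b.toRat)).toRat) ∧
    (¬ ∀ a b : MiniFloat E2M3,
      (roundNE E2M3 (roundNE Binary8p4F (a.toRat * b.toRat)).toRat).toRat
        = (roundNE E2M3 (a.toRat * b.toRat)).toRat) := by
  refine ⟨fun h => ?_, fun h => ?_, fun h => ?_, fun h => ?_, fun h => ?_, fun h => ?_⟩
  · have := h ⟨false, 0, 3, by decide, by decide, by decide⟩
      ⟨false, 2, 3, by decide, by decide, by decide⟩
    revert this; decide +kernel
  · have := h ⟨false, 0, 3, by decide, by decide, by decide⟩
      ⟨false, 2, 3, by decide, by decide, by decide⟩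
    revert this; decide +kernel
  · have := h ⟨false, 0, 3, by decide, by decide, by decide⟩
      ⟨false, 2, 3, by decide, by decide, by decide⟩
    revert this; decide +kernel
  · have := h ⟨false, 0, 3, by decide, by decide, by decide⟩
      ⟨false, 0, 7, by decide, by decide, by decide⟩
    revert this; decide +kernel
  · have := h ⟨false, 0, 3, by decide, by decide, by decide⟩
      ⟨false, 0, 7, by decide, by decide, by decide⟩
    revert this; decide +kernel
  · have := h ⟨false, 0, 3, by decide, by decide, by decide⟩
      ⟨false, 0, 7, by decide, by decide, by decide⟩
    revert this; decide +kernel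

/-- `P_Y < 2 P_X` FAILS at higher precision too: e2m3 → binary8p5 (`5/8 · 15/8 = 75/64 ↦ 19/16
↦ 5/4`, direct `9/8`) and binary8p5 → bfloat16 (`P_Y = 8 < 10`: `9/128 · 31/16 = 279/2048 ↦
35/256 ↦ 9/64`, direct `17/128`) — the one FP8-through-16-bit product cell that fails. -/
theorem precisionDeficient_mul_fails :
    (¬ ∀ a b : MiniFloat E2M3, (roundNE E2M3 (roundNE Binary8p5 (a.toRat * b.toRat)).toRat).toRat
      = (roundNE E2M3 (a.toRat * b.toRat)).toRat) ∧
    (¬ ∀ a b : MiniFloat Binary8p5,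
      (roundNE Binary8p5 (roundNE BFloat16 (a.toRat * b.toRat)).toRat).toRat
        = (roundNE Binary8p5 (a.toRat * b.toRat)).toRat) := by
  refine ⟨fun h => ?_, fun h => ?_⟩
  · have := h ⟨false, 0, 5, by decide, by decide, by decide⟩
      ⟨false, 1, 7, by decide, by decide, by decide⟩
    revert this; decide +kernel
  · have := h ⟨false, 0, 9, by decide, by decide, by decide⟩
      ⟨false, 4, 15, by decide, by decide, by decide⟩
    revert this; decide +kernel

end Summit.Ventures.CertifiedArithmetic
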